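import Mathlib
import Literature.NumberTheory.LFunctions.Zhang2022.Section10cEval1214Tools
import Literature.NumberTheory.LFunctions.Zhang2022.Section10cFrakv2SWindows
import Literature.NumberTheory.LFunctions.Zhang2022.Section10cTop1214Int
import Literature.NumberTheory.LFunctions.Zhang2022.Section10Range1113LowM
import Literature.NumberTheory.LFunctions.Zhang2022.Section10Range1321MidRel
import Literature.NumberTheory.LFunctions.Zhang2022.TypedSection12A
import HarnessLib

/-!
# Zhang (2022) §10c: the top range `P^{0.498} ≤ dr < P^{0.5}` of `S_j(𝐚₁₂,𝐚₁₄)` — node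
# Z22:§10.u057 (i), `Typed.Sec10C.Top1214Eval c′`, PROVED (for `c′ ≥ 0`)

Topic `Literature/NumberTheory/LFunctions/Zhang2022` (Landau–Siegel audit tree; verdict-neutral).
Y. Zhang, *Discrete mean estimates and the Landau–Siegel zero*, arXiv:2211.02515v1 (2022)
[Zhang2022LandauSiegel], §10 p. 61 (tex L3101, first line): "the sum over `P^{0.498} ≤ dr < P^{0.5}`
is equal to `(1000ῑ₄L′(1,χ)²/log²P) Σ_{P^{0.498}≤n<P^{0.5}} |χ(n)|λ₀ⱼ(n)φ(n)⁻¹𝔣_{j7}(P^{0.5}/n)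
(1 + 𝔶_{2j}(P^{0.004}n)) + o(α)`" — **an unrefereed manuscript under adjudication; this file proves
that sentence over the tree's objects and asserts nothing about Theorems 1–2.** ZHANG-L discharge lane
(WP10, seat zl-w10-p2; helper under the leaf `Typed.Sec10C.Gather1214` held by zl-w10-p1, split
Low/Mid/Top = p4/p1/p2).

THE ARGUMENT ("By a result similar to Lemma 10.2 and the results in Section 8"), made explicit. With
`n = dr` in `[P^{0.498}, P^{0.5})`, the `(d,r)`-term of `S_j(𝐚₁₂,𝐚₁₄)` is `w(d,r)·M(n)·N(d,r)`:

* `M(n) = Σ_m χ(m)(ῑ₃ϰ₃ + ῑ₄ϰ₂)(nm)m^{β_j−1}` ("the results in Section 8" = Lemma 8.2): the `ϰ₃`-part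
  is EMPTY (`nm ≥ n ≥ P₃`), the `ϰ₂`-part is `ῑ₄(log P₂)⁻¹·[Lemma 8.2's sum at x = P₂/n, μ = 7]`
  (zl-w10-p1's `mSum12_eq`); for `n < P^{0.5}T⁻¹¹` one has `x > T` and Lemma 8.2 (tree theorem
  `Skeleton.lemma82_holds`) evaluates it as `L′(1,χ)𝔣_{j7}(P₂/n) + O(𝓛⁻⁶)`, and `𝔣_{j7}(P₂/n)/log P₂ =
  𝔣_{j7}(P^{0.5}/n)/(0.5 log P) + O(𝓛^{1.1}α𝓛⁻⁹)` (p1's `norm_frakfW7_P2_div_sub_le`); for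
  `n ≥ P^{0.5}T⁻¹¹` only the crude `|sum| ≤ (1 + log x)log x ≤ (1+𝓛^{1.1})𝓛^{1.1}` (`x ≤ T`) or `0`
  (`x ≤ 1`) is used;
* `N(d,r) = Σ_n χ(n)f̃(log(drn)/log P + 0.004 − α̃)ξ₀ⱼ(n;d,r)/n = frakv2S` ("a result similar to
  Lemma 10.2"): for `P^{0.498}Dt₀ < n < P^{0.5}T⁻¹¹` the shifted argument `y* = nP^{0.004}/(Dt₀)` lies in
  `(P^{0.502}, P^{0.504}/T]` and the shifted (10.10) in relative form (p1's
  `Lemma102.eq1010SRel_of_logMean` ∘ p6's `logMeanRel_of_lemma83Rel` ∘ WP09's `lemma83Rel_holds`)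
  gives `N = (500L′Π(d,r)/log P)(1 + 𝔶₂ⱼ(y*)) + O(𝓛⁻¹⁵R(d,r))`, and `𝔶₂ⱼ(y*) = 𝔶₂ⱼ(P^{0.004}n) + O(α𝓛)`
  (`norm_fraky2_yShift_sub_le`); elsewhere the weak window bound `‖N‖ ≤ C𝓛⁻⁴R(d,r)`
  (`Lemma102.frakv2S_le_ell4`);
* the `Π(d,r)` collapse (8.10) (`Section8FrontEnd810.eq810_holds`) and L3-t4's abstract assembly
  `Ranges1422.range_assembly_bound₃` with its weight sums `top_weights_all_le`/`top_weights_window_le`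
  (the main set `P^{0.498}Dt₀ < n < P^{0.5}T⁻¹¹` is the one of the `S_j(𝐚₁₄,𝐚₂₂)` top range);
* total `≪_{c′} (𝓛^{1.1})⁵𝓛⁻¹⁵ = o(α)` (`Ranges1422.K_tau5_le_eps_alpha`).

Main results: `top1214_at` (fixed modulus), `top1214Eval_holds : 0 ≤ c′ → Top1214Eval c′`.
Theorem-only; no definitions, no named facts; nothing about Landau–Siegel zeros.

## References

* Y. Zhang, arXiv:2211.02515v1 (2022), §10 p. 61, Lemma 10.2 p. 55, Remark p. 57, (10.10);
  §8 Lemma 8.2, (8.6), (8.10). [cite: Zhang2022LandauSiegel, §10 p. 61]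
-/

noncomputable section

open Complex Real ComplexConjugate Finset

namespace Literature.NumberTheory.LFunctions.Zhang2022.Typed.Sec10C

open Literature.NumberTheory.LFunctions.Zhang2022.Skeleton
open Literature.NumberTheory.LFunctions.Zhang2022.Typed.Sec10B (yShift frakv2S)
open Ranges1422

namespace Top1214

section Pointwise

variable (c' : ℝ) {D : ℕ} (χ : DirichletCharacter ℂ D)

/-- `mSum12` depends on `(d,r)` only through `dr`: `mSum12(n/r, r) = mSum12(n, 1)` for `r ∣ n`.
[cite: Zhang2022LandauSiegel, §10 p. 60] -/
theorem mSum12_eq_of_dvd (j : ℕ) {n r : ℕ} (hrn : r ∣ n) :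
    Sec10C.mSum12 c' χ j (n / r) r = Sec10C.mSum12 c' χ j n 1 := by
  unfold Sec10C.mSum12
  rw [Nat.div_mul_cancel hrn, Nat.mul_one]

/-- **Re-indexing `S1214On` by `n = dr`.** For `𝓛 ≥ 3` and a range `[lo, hi)` inside `[0, ⌈PT⁻²⌉)`:
`S1214On(j; lo, hi) = Σ_{lo ≤ n < hi} Σ_{r ∣ n, r squarefree} a(n)φ(r)⁻¹·mSum12(n)·nSum14(n/r, r)`,
`a(n) = |χ(n)|λ₀ⱼ(n)/n`. [cite: Zhang2022LandauSiegel, §10 pp. 60–61] -/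
theorem S1214On_eq_divisor_sum [NeZero D] (j : ℕ) {lo hi : ℝ}
    (hhi : ∀ n : ℕ, (n : ℝ) < hi → n < Nsupp D) :
    S1214On c' χ j lo hi =
      ∑ n ∈ (Finset.Ico 1 (Nsupp D)).filter (fun n : ℕ => lo ≤ (n : ℝ) ∧ (n : ℝ) < hi),
        ∑ r ∈ n.divisors,
          (if Squarefree r then
            (‖χ (n : ZMod D)‖ : ℂ) * lamZero c' D j n / (n : ℂ) / (Nat.totient r : ℂ) *
              Sec10C.mSum12 c' χ j n 1 * Sec10C.nSum14 c' χ j (n / r) r else 0) := by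
  classical
  unfold S1214On
  rw [Finset.sum_comm]
  rw [sum_box_ite_eq_sum_divisors (Nsupp D) (fun n : ℕ => lo ≤ (n : ℝ) ∧ (n : ℝ) < hi)
    (fun n hn => hhi n hn.2) (fun d r => term1214 c' χ j d r)]
  refine Finset.sum_congr rfl fun n hn => Finset.sum_congr rfl fun r hr => ?_
  have hn0 : n ≠ 0 := by
    have := (Finset.mem_Ico.mp (Finset.mem_filter.mp hn).1).1; omega
  have hrd : r ∣ n := Nat.dvd_of_mem_divisors hr
  have hdr : n / r * r = n := Nat.div_mul_cancel hrd
  unfold term1214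
  rw [norm_chi_mul_norm_moebius_chi χ (n / r) r]
  split_ifs with hsq
  · rw [mSum12_eq_of_dvd c' χ j hrd, hdr]
    ring
  · simp

/-- **The `m`-sum on the top range** (`n ≥ P₃ = P^{0.498}`, so the `ϰ₃`-part is empty):
`mSum12(n) = ῑ₄(log P₂)⁻¹·[Lemma 8.2's sum at x = P₂/n, μ = 7]`. [cite: Zhang2022LandauSiegel, §10 p. 61] -/
theorem mSum12_top_eq (hD : 2 ≤ Real.log D) (j : ℕ) {n : ℕ} (hn : 1 ≤ n)
    (hlo : Skeleton.P3 D ≤ (n : ℝ)) :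
    Sec10C.mSum12 c' χ j n 1 =
      conj iota4 * ((1 / (Real.log (Skeleton.P2 D) : ℂ)) *
        ∑ m ∈ Finset.Ico 1 ⌈Skeleton.P2 D / (n : ℝ)⌉₊,
          χ (m : ZMod D) / (m : ℂ) ^ (1 - betaJ c' D j) *
            (((Skeleton.P2 D / (n : ℝ)) / m : ℝ) : ℂ) ^ beta7 D *
              (Real.log ((Skeleton.P2 D / (n : ℝ)) / m) : ℂ)) := by
  have h := mSum12_eq c' χ hD j hn (le_refl 1)
  simp only [Nat.mul_one] at h
  have hn0 : (0 : ℝ) < n := by exact_mod_cast hn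
  have hempty : Finset.Ico 1 ⌈Skeleton.P3 D / (n : ℝ)⌉₊ = ∅ := by
    apply Finset.Ico_eq_empty_of_le
    exact Nat.ceil_le.mpr (by rw [Nat.cast_one]; exact div_le_one_of_le₀ hlo hn0.le)
  rw [h, hempty, Finset.sum_empty, mul_zero, mul_zero, zero_add]

set_option maxHeartbeats 400000 in
-- explicit-constant bookkeeping with several `set` abbreviations; modest margin over the default
/-- **The `y* ↦ P^{0.004}y` replacement in `𝔶₂ⱼ`**: for `𝓛 ≥ 3`, `5|c′|α𝓛 ≤ 1` and
`P^{0.496} ≤ y ≤ P^{0.5}`: `‖𝔶₂ⱼ(y*) − 𝔶₂ⱼ(P^{0.004}y)‖ ≤ 8500·α·𝓛` where `y* = yP^{0.004}/(Dt₀)` (the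
logarithm `log(P^{0.504}/·)` shifts by `log(Dt₀) ≤ 520𝓛`; `‖β‖ ≤ 4α`).
[cite: Zhang2022LandauSiegel, §10 (10.10), Remark p. 57] -/
theorem norm_fraky2_yShift_sub_le (hℓ : 3 ≤ ell D) (hc : 5 * |c'| * alpha D * ell D ≤ 1) (j : ℕ)
    {y : ℝ} (hlo : bigP D ^ (0.496 : ℝ) ≤ y) (hhi : y ≤ bigP D ^ (0.5 : ℝ)) :
    ‖fraky2 c' D j (yShift D y) - fraky2 c' D j (bigP D ^ (0.004 : ℝ) * y)‖ ≤
      8500 * alpha D * ell D := by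
  have hℓ0 : 0 < ell D := by linarith
  have hℓ1 : 1 ≤ ell D := by linarith
  obtain ⟨hα, hαeq, hαℓ9⟩ := alpha_facts (D := D) hℓ
  have hP0 : 0 < bigP D := Real.exp_pos _
  have hP1 : 1 ≤ bigP D := by
    have := Real.one_le_exp (show (0:ℝ) ≤ ell D ^ 9 by positivity); rwa [bigP]
  have h496 : 0 < bigP D ^ (0.496 : ℝ) := Real.rpow_pos_of_pos hP0 _
  have hy0 : 0 < y := lt_of_lt_of_le h496 hlo
  have hDt1 := Dt0_ge_one (D := D) hℓ
  have hDt0 := Dt0_pos (D := D) hℓ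
  have hDtlog := log_Dt0_le (D := D) hℓ
  have hDtlog0 : 0 ≤ Real.log ((D : ℝ) * t0 D) := Real.log_nonneg hDt1
  have h004 : 0 < bigP D ^ (0.004 : ℝ) := Real.rpow_pos_of_pos hP0 _
  -- the two logarithms
  set L : ℝ := Real.log (bigP D ^ (0.504 : ℝ) / (bigP D ^ (0.004 : ℝ) * y)) with hL
  set Δ : ℝ := Real.log ((D : ℝ) * t0 D) with hΔ
  have hys : yShift D y = bigP D ^ (0.004 : ℝ) * y / ((D : ℝ) * t0 D) := by
    rw [yShift]; ring
  have hLs : Real.log (bigP D ^ (0.504 : ℝ) / yShift D y) = L + Δ := by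
    rw [hys, hL, hΔ, div_div_eq_mul_div, Real.log_div (by positivity) (by positivity),
      Real.log_mul (by positivity) hDt0.ne', Real.log_div (by positivity) (by positivity)]
    ring
  -- `0 ≤ L ≤ 0.008·𝓛⁹`
  have hL504 : bigP D ^ (0.504 : ℝ) = bigP D ^ (0.004 : ℝ) * bigP D ^ (0.5 : ℝ) := by
    rw [← Real.rpow_add hP0]; norm_num
  have hL0 : 0 ≤ L := by
    rw [hL]
    apply Real.log_nonneg
    rw [le_div_iff₀ (by positivity), one_mul, hL504]
    exact mul_le_mul_of_nonneg_left hhi h004.le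
  have hLle : L ≤ 0.004 * ell D ^ 9 := by
    rw [hL, Real.log_div (by positivity) (by positivity), Real.log_mul h004.ne' hy0.ne',
      Real.log_rpow hP0, Real.log_rpow hP0, Sec12A.log_bigP D]
    have hlogy : 0.496 * ell D ^ 9 ≤ Real.log y := by
      have := Real.log_le_log h496 hlo
      rwa [Real.log_rpow hP0, Sec12A.log_bigP D] at this
    linarith
  -- the shifts
  set S : ℂ := betaJ c' D (j + 1) + betaJ c' D (j + 2) with hS
  set Pr : ℂ := betaJ c' D (j + 1) * betaJ c' D (j + 2) with hPr
  have hβ1 := Section8AbelProfiles.norm_betaJ_le c' hα.le hℓ0.le hc (j + 1)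
  have hβ2 := Section8AbelProfiles.norm_betaJ_le c' hα.le hℓ0.le hc (j + 2)
  have hSn : ‖S‖ ≤ 8 * alpha D := (norm_add_le _ _).trans (by linarith)
  have hPrn : ‖Pr‖ ≤ (4 * alpha D) * (4 * alpha D) := by
    rw [hPr, norm_mul]; exact mul_le_mul hβ1 hβ2 (norm_nonneg _) (by positivity)
  have hdiff : fraky2 c' D j (yShift D y) - fraky2 c' D j (bigP D ^ (0.004 : ℝ) * y) =
      S * (Δ : ℂ) + Pr / 2 * ((Δ : ℂ) * (2 * (L : ℂ) + (Δ : ℂ))) := by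
    simp only [fraky2, hLs, ← hL, hS, hPr]
    push_cast
    ring
  rw [hdiff]
  have hΔn : ‖(Δ : ℂ)‖ = Δ := by rw [Complex.norm_real, Real.norm_of_nonneg hDtlog0]
  have hLn : ‖(L : ℂ)‖ = L := by rw [Complex.norm_real, Real.norm_of_nonneg hL0]
  have h2LΔ : ‖2 * (L : ℂ) + (Δ : ℂ)‖ ≤ 2 * L + Δ := by
    calc ‖2 * (L : ℂ) + (Δ : ℂ)‖ ≤ ‖2 * (L : ℂ)‖ + ‖(Δ : ℂ)‖ := norm_add_le _ _
      _ = 2 * L + Δ := by rw [norm_mul, Complex.norm_two, hLn, hΔn]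
  -- sizes: `Δ ≤ 520𝓛`, `αL ≤ 0.004π`, `αΔ ≤ 520π/𝓛⁸ ≤ 1`
  have hαΔ : alpha D * Δ ≤ 520 * alpha D * ell D := by
    have := mul_le_mul_of_nonneg_left hDtlog hα.le; linarith
  have hαℓ : alpha D * ell D = π / ell D ^ 8 := by
    rw [hαeq]; field_simp
  have hαℓ1 : 520 * alpha D * ell D ≤ 1 := by
    rw [mul_assoc, hαℓ]
    have h8 : (3 : ℝ) ^ 8 ≤ ell D ^ 8 := pow_le_pow_left₀ (by norm_num) hℓ 8
    rw [← mul_div_assoc, div_le_one (by positivity)]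
    nlinarith [Real.pi_lt_d2]
  have hαL : alpha D * L ≤ 0.004 * π := by
    calc alpha D * L ≤ alpha D * (0.004 * ell D ^ 9) := mul_le_mul_of_nonneg_left hLle hα.le
      _ = 0.004 * (alpha D * ell D ^ 9) := by ring
      _ = 0.004 * π := by rw [hαℓ9]
  have t1 : ‖S * (Δ : ℂ)‖ ≤ 8 * alpha D * Δ := by
    clear_value S Pr
    rw [norm_mul, hΔn]; exact mul_le_mul_of_nonneg_right hSn hDtlog0
  have t2 : ‖Pr / 2 * ((Δ : ℂ) * (2 * (L : ℂ) + (Δ : ℂ)))‖ ≤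
      (4 * alpha D) * (4 * alpha D) / 2 * (Δ * (2 * L + Δ)) := by
    clear_value S Pr
    rw [norm_mul, norm_div, Complex.norm_two, norm_mul, hΔn]
    have hΔ2 : 0 ≤ 2 * L + Δ := by positivity
    gcongr
  calc ‖S * (Δ : ℂ) + Pr / 2 * ((Δ : ℂ) * (2 * (L : ℂ) + (Δ : ℂ)))‖
      ≤ ‖S * (Δ : ℂ)‖ + ‖Pr / 2 * ((Δ : ℂ) * (2 * (L : ℂ) + (Δ : ℂ)))‖ := norm_add_le _ _
    _ ≤ 8 * alpha D * Δ + (4 * alpha D) * (4 * alpha D) / 2 * (Δ * (2 * L + Δ)) :=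
        add_le_add t1 t2
    _ = (alpha D * Δ) * (8 + 16 * (alpha D * L) + 8 * (alpha D * Δ)) := by ring
    _ ≤ (520 * alpha D * ell D) * (8 + 16 * (0.004 * π) + 8 * 1) := by
        have h0 : 0 ≤ alpha D * Δ := by positivity
        gcongr
        · linarith
    _ ≤ (520 * alpha D * ell D) * 16.21 := by
        have hπ := Real.pi_lt_d2
        have h0 : 0 ≤ 520 * alpha D * ell D := by positivity
        exact mul_le_mul_of_nonneg_left (by linarith) h0
    _ ≤ 8500 * alpha D * ell D := by
        have h0 : 0 ≤ alpha D * ell D := by positivity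
        linarith

end Pointwise

/-! ## The `m`-side at a fixed modulus: main evaluation and crude bound -/

section MSide

variable (c' : ℝ) {D : ℕ} [NeZero D] (χ : DirichletCharacter ℂ D)

/-- **Main evaluation of the `m`-sum on the good part of the top range.** For `𝓛 ≥ 5`,
`5|c′|α𝓛 ≤ 1`, `P^{0.498} ≤ n < P^{0.5}T⁻¹¹` and Lemma 8.2 (body, constant `C₈₂ ≥ 0`) at this modulus:
`‖mSum12(n) − ῑ₄L′(1,χ)𝔣_{j7}(P^{0.5}/n)/(0.5 log P)‖ ≤ ‖ι₄‖(C₈₂𝓛⁻⁶/log P₂ + |L′(1,χ)|·5000𝓛^{1.1}α𝓛⁻⁹)`.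
[cite: Zhang2022LandauSiegel, §10 p. 61; §8 Lemma 8.2] -/
theorem norm_mSum12_top_main_le (hℓ5 : 5 ≤ ell D) (hc : 5 * |c'| * alpha D * ell D ≤ 1) (j : ℕ)
    {C82 : ℝ}
    (h82 : ∀ y : ℝ, bigT D < y → y < bigP D →
      ‖(∑ m ∈ Finset.Ico 1 ⌈y⌉₊, χ (m : ZMod D) / (m : ℂ) ^ (1 - betaJ c' D j) *
            ((y / m : ℝ) : ℂ) ^ betaMu D 7 * (Real.log (y / m) : ℂ)) -
          deriv χ.LFunction 1 * frakfW c' D j 7 y‖ ≤ C82 * (ell D ^ 6)⁻¹)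
    {n : ℕ} (hlo : bigP D ^ (0.498 : ℝ) ≤ (n : ℝ))
    (hhi : (n : ℝ) < bigP D ^ (0.5 : ℝ) / bigT D ^ 11) :
    ‖Sec10C.mSum12 c' χ j n 1 -
        conj iota4 * deriv χ.LFunction 1 *
          (frakfW c' D j 7 (bigP D ^ (0.5 : ℝ) / n) / ((0.5 * Real.log (bigP D) : ℝ) : ℂ))‖ ≤
      ‖iota4‖ * (C82 * (ell D ^ 6)⁻¹ / Real.log (Skeleton.P2 D) +
        ‖deriv χ.LFunction 1‖ * (5000 * ell D ^ (1.1 : ℝ) * alpha D / ell D ^ 9)) := by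
  have hℓ : 3 ≤ ell D := by linarith
  have hℓ0 : 0 < ell D := by linarith
  have hlog2 : 2 ≤ Real.log D := by rw [← ell]; linarith
  obtain ⟨h2, hab, hb5, -, -, h5P, -⟩ := range_facts (D := D) hℓ
  have hT := bigT_pos D
  have hT1 : 1 ≤ bigT D := by
    rw [bigT]; exact Real.one_le_exp (Real.rpow_nonneg hℓ0.le _)
  have hn1r : (1 : ℝ) ≤ n := by linarith [h2.trans (hab.trans hlo)]
  have hn1 : 1 ≤ n := by exact_mod_cast hn1r
  have hn0 : (0 : ℝ) < n := by linarith
  have hhi' : (n : ℝ) < bigP D ^ (0.5 : ℝ) :=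
    lt_of_lt_of_le hhi (div_le_self (Real.rpow_nonneg (Real.exp_pos _).le _) (one_le_pow₀ hT1))
  have hP3 : Skeleton.P3 D ≤ (n : ℝ) := hlo
  -- Lemma 8.2 at `x = P₂/n ∈ (T, P)`
  set x : ℝ := Skeleton.P2 D / (n : ℝ) with hx
  have hxT : bigT D < x := by
    rw [hx, Skeleton.P2, lt_div_iff₀ hn0]
    rw [lt_div_iff₀ (pow_pos hT 11)] at hhi
    rw [lt_div_iff₀ (pow_pos hT 10)]
    calc bigT D * n * bigT D ^ 10 = n * bigT D ^ 11 := by ring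
      _ < bigP D ^ (0.5 : ℝ) := hhi
  have hxP : x < bigP D := by
    rw [hx]
    exact lt_of_le_of_lt (div_le_self (le_of_lt (lt_trans zero_lt_one (Ranges1422.one_lt_P2 hℓ))) hn1r)
      (P2_lt_bigP hℓ)
  have h82x := h82 x hxT hxP
  rw [betaMu_seven_eq] at h82x
  have hlogP2 := log_P2_pos (D := D) hℓ
  -- the identity and the split
  rw [mSum12_top_eq c' χ hlog2 j hn1 hP3]
  set S82 := ∑ m ∈ Finset.Ico 1 ⌈x⌉₊, χ (m : ZMod D) / (m : ℂ) ^ (1 - betaJ c' D j) *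
    ((x / m : ℝ) : ℂ) ^ beta7 D * (Real.log (x / m) : ℂ) with hS82
  set L1 := deriv χ.LFunction 1
  set E := S82 - L1 * frakfW c' D j 7 x with hE
  have hswap := norm_frakfW7_P2_div_sub_le c' hℓ5 hc j hn1 (hab.trans hlo) hhi'
  have e : conj iota4 * ((1 / (Real.log (Skeleton.P2 D) : ℂ)) * S82) -
      conj iota4 * L1 * (frakfW c' D j 7 (bigP D ^ (0.5 : ℝ) / n) /
        ((0.5 * Real.log (bigP D) : ℝ) : ℂ)) =
      conj iota4 * (E * (1 / (Real.log (Skeleton.P2 D) : ℂ)) +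
        L1 * (frakfW c' D j 7 x / (Real.log (Skeleton.P2 D) : ℂ) -
          frakfW c' D j 7 (bigP D ^ (0.5 : ℝ) / n) / ((0.5 * Real.log (bigP D) : ℝ) : ℂ))) := by
    rw [hE]; ring
  rw [e, norm_mul, RCLike.norm_conj]
  refine mul_le_mul_of_nonneg_left ?_ (norm_nonneg _)
  refine (norm_add_le _ _).trans (add_le_add ?_ ?_)
  · rw [norm_mul, norm_div, norm_one, Complex.norm_real, Real.norm_of_nonneg hlogP2.le,
      ← div_eq_mul_one_div]
    exact div_le_div_of_nonneg_right h82x hlogP2.le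
  · rw [norm_mul]
    exact mul_le_mul_of_nonneg_left hswap (norm_nonneg _)

/-- **Crude bound for the `m`-sum on the whole top range** (`P^{0.498} ≤ n < P^{0.5}`): with
`x = P₂/n`, either `x ≤ 1` (empty sum), `1 < x ≤ T` (`(1 + log x)log x ≤ (1 + 𝓛^{1.1})𝓛^{1.1}`), or
`T < x < P` (Lemma 8.2: `|L′|·29 + C₈₂𝓛⁻⁶`); in all cases
`‖mSum12(n)‖ ≤ ‖ι₄‖(log P₂)⁻¹((1 + 𝓛^{1.1})𝓛^{1.1} + 29|L′(1,χ)| + C₈₂𝓛⁻⁶)`.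
[cite: Zhang2022LandauSiegel, §10 p. 61; §8 Lemma 8.2] -/
theorem norm_mSum12_top_crude_le (hℓ5 : 5 ≤ ell D) (hc : 5 * |c'| * alpha D * ell D ≤ 1) (j : ℕ)
    {C82 : ℝ} (hC82 : 0 ≤ C82)
    (h82 : ∀ y : ℝ, bigT D < y → y < bigP D →
      ‖(∑ m ∈ Finset.Ico 1 ⌈y⌉₊, χ (m : ZMod D) / (m : ℂ) ^ (1 - betaJ c' D j) *
            ((y / m : ℝ) : ℂ) ^ betaMu D 7 * (Real.log (y / m) : ℂ)) -
          deriv χ.LFunction 1 * frakfW c' D j 7 y‖ ≤ C82 * (ell D ^ 6)⁻¹)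
    {n : ℕ} (hlo : bigP D ^ (0.498 : ℝ) ≤ (n : ℝ)) (hhi : (n : ℝ) < bigP D ^ (0.5 : ℝ)) :
    ‖Sec10C.mSum12 c' χ j n 1‖ ≤
      ‖iota4‖ * (Real.log (Skeleton.P2 D))⁻¹ *
        ((1 + ell D ^ (1.1 : ℝ)) * ell D ^ (1.1 : ℝ) + 29 * ‖deriv χ.LFunction 1‖ +
          C82 * (ell D ^ 6)⁻¹) := by
  have hℓ : 3 ≤ ell D := by linarith
  have hℓ0 : 0 < ell D := by linarith
  have hlog2 : 2 ≤ Real.log D := by rw [← ell]; linarith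
  obtain ⟨h2, hab, hb5, -, -, h5P, -⟩ := range_facts (D := D) hℓ
  obtain ⟨hα, hαeq, hαℓ9⟩ := alpha_facts (D := D) hℓ
  have hT := bigT_pos D
  have hn1r : (1 : ℝ) ≤ n := by linarith [h2.trans (hab.trans hlo)]
  have hn1 : 1 ≤ n := by exact_mod_cast hn1r
  have hn0 : (0 : ℝ) < n := by linarith
  have hnP : (n : ℝ) ≤ bigP D := by linarith
  have hP1 : 1 < bigP D := by rw [bigP]; exact Real.one_lt_exp_iff.2 (by positivity)
  have hlogP2 := log_P2_pos (D := D) hℓ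
  have hτ0 : 0 ≤ ell D ^ (1.1 : ℝ) := Real.rpow_nonneg hℓ0.le _
  have hlogT : Real.log (bigT D) = ell D ^ (1.1 : ℝ) := by rw [bigT, Real.log_exp]
  rw [mSum12_top_eq c' χ hlog2 j hn1 hlo, norm_mul, RCLike.norm_conj, norm_mul, norm_div, norm_one,
    Complex.norm_real, Real.norm_of_nonneg hlogP2.le, one_div, mul_assoc]
  refine mul_le_mul_of_nonneg_left (mul_le_mul_of_nonneg_left ?_ (by positivity)) (norm_nonneg _)
  set x : ℝ := Skeleton.P2 D / (n : ℝ) with hx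
  have hxP : x < bigP D := by
    rw [hx]
    exact lt_of_le_of_lt (div_le_self (le_of_lt (lt_trans zero_lt_one (Ranges1422.one_lt_P2 hℓ))) hn1r)
      (P2_lt_bigP hℓ)
  have hA0 : 0 ≤ (1 + ell D ^ (1.1 : ℝ)) * ell D ^ (1.1 : ℝ) := by positivity
  have hB0 : 0 ≤ 29 * ‖deriv χ.LFunction 1‖ := by positivity
  have hC0 : 0 ≤ C82 * (ell D ^ 6)⁻¹ := by positivity
  rcases le_or_gt x 1 with hx1 | hx1
  · -- empty sum
    have hempty : Finset.Ico 1 ⌈x⌉₊ = ∅ :=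
      Finset.Ico_eq_empty_of_le (Nat.ceil_le.mpr (by simpa using hx1))
    rw [hempty, Finset.sum_empty, norm_zero]
    positivity
  rcases le_or_gt x (bigT D) with hxT | hxT
  · -- crude
    have hcr := Skeleton.norm_lemma82Sum7_crude c' χ j hx1.le
    have hlx : Real.log x ≤ ell D ^ (1.1 : ℝ) := by
      rw [← hlogT]; exact Real.log_le_log (by linarith) hxT
    have hlx0 : 0 ≤ Real.log x := Real.log_nonneg hx1.le
    calc _ ≤ (1 + Real.log x) * Real.log x := hcr
      _ ≤ (1 + ell D ^ (1.1 : ℝ)) * ell D ^ (1.1 : ℝ) := by gcongr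
      _ ≤ _ := by linarith
  · -- Lemma 8.2
    have h82x := h82 x hxT hxP
    rw [betaMu_seven_eq] at h82x
    have hαlog : alpha D * Real.log (bigP D) ≤ 4 := by
      rw [Sec12A.log_bigP D, hαℓ9]; linarith [Real.pi_lt_d2]
    have hQ1 : 1 ≤ Skeleton.P2 D := (Ranges1422.one_lt_P2 hℓ).le
    have hQP : Skeleton.P2 D ≤ bigP D := (P2_lt_bigP hℓ).le
    have hf := (Section8AbelProfiles.frakfW_div_bounds c' j 7 hα hℓ0.le hc hQ1 hQP hn1r hnP
      hαlog).2.1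
    calc _ ≤ ‖deriv χ.LFunction 1 * frakfW c' D j 7 x‖ +
          ‖(∑ m ∈ Finset.Ico 1 ⌈x⌉₊, χ (m : ZMod D) / (m : ℂ) ^ (1 - betaJ c' D j) *
              ((x / m : ℝ) : ℂ) ^ beta7 D * (Real.log (x / m) : ℂ)) -
            deriv χ.LFunction 1 * frakfW c' D j 7 x‖ := norm_le_norm_add_norm_sub' _ _
      _ ≤ ‖deriv χ.LFunction 1‖ * 29 + C82 * (ell D ^ 6)⁻¹ := by
          rw [norm_mul]; exact add_le_add (mul_le_mul_of_nonneg_left hf (norm_nonneg _)) h82x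
      _ ≤ _ := by linarith

end MSide


/-! ## The range assembly at a fixed modulus -/

section Assembly

variable (c' : ℝ) {D : ℕ} [NeZero D] (χ : DirichletCharacter ℂ D)

set_option maxHeartbeats 400000 in
/-- **Top range of `S_j(𝐚₁₂,𝐚₁₄)`, the range assembly.** With Lemma 8.2 (body `h82`), the shifted
(10.10) in relative form (body `h10S`) and the weak window bound for the shifted `𝔳₂ⱼ`-sum (body
`hWN`) at this modulus: the re-indexed range sum minus the collapsed (printed) main term is bounded
by the weighted main-range (`P^{0.498}Dt₀ < n < P^{0.5}T⁻¹¹`) and window contributions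
(`Ranges1422.range_assembly_bound₃`). [cite: Zhang2022LandauSiegel, §10 p. 61] -/
theorem top1214_assembly_le (hℓ5 : 5 ≤ ell D) (hq : χ.IsQuadratic)
    (hc5 : 5 * |c'| * alpha D * ell D ≤ 1) {C82 C₂ C₃ : ℝ} (hC82 : 0 ≤ C82)
    (h82 : ∀ j ∈ ({1, 2, 3} : Finset ℕ), ∀ μ ∈ ({6, 7} : Finset ℕ), ∀ y : ℝ, bigT D < y →
      y < bigP D →
      ‖(∑ m ∈ Finset.Ico 1 ⌈y⌉₊, χ (m : ZMod D) / (m : ℂ) ^ (1 - betaJ c' D j) *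
            ((y / m : ℝ) : ℂ) ^ betaMu D μ * (Real.log (y / m) : ℂ)) -
          deriv χ.LFunction 1 * frakfW c' D j μ y‖ ≤ C82 * (ell D ^ 6)⁻¹)
    (h10S : ∀ j ∈ ({1, 2, 3} : Finset ℕ), ∀ d r : ℕ, 1 ≤ d → 1 ≤ r →
      bigP D ^ (0.502 : ℝ) < yShift D ((d * r : ℕ) : ℝ) →
      yShift D ((d * r : ℕ) : ℝ) ≤ bigP D ^ (0.504 : ℝ) / bigT D →
        ‖frakv2S c' χ j d r - 500 * deriv χ.LFunction 1 * PiW χ d r / Real.log (bigP D) *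
            (1 + fraky2 c' D j (yShift D ((d * r : ℕ) : ℝ)))‖ ≤
          C₂ * (ell D ^ 15)⁻¹ * (∏ q ∈ (d * r).primeFactors, (1 - (q : ℝ)⁻¹)⁻¹) ^ 2)
    (hWN : ∀ j ∈ ({1, 2, 3} : Finset ℕ), ∀ d r : ℕ, 1 ≤ d → 1 ≤ r →
      ((d * r : ℕ) : ℝ) < bigP D ^ (0.5 : ℝ) →
        ‖frakv2S c' χ j d r‖ ≤
          C₃ * (ell D ^ 4)⁻¹ * (∏ q ∈ (d * r).primeFactors, (1 - (q : ℝ)⁻¹)⁻¹) ^ 2)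
    {j : ℕ} (hj : j ∈ ({1, 2, 3} : Finset ℕ)) :
    ‖(∑ n ∈ (Finset.Ico 1 (Nsupp D)).filter
        (fun n : ℕ => bigP D ^ (0.498 : ℝ) ≤ (n : ℝ) ∧ (n : ℝ) < bigP D ^ (0.5 : ℝ)),
        ∑ r ∈ n.divisors,
          (if Squarefree r then
            (‖χ (n : ZMod D)‖ : ℂ) * lamZero c' D j n / (n : ℂ) / (Nat.totient r : ℂ) *
              Sec10C.mSum12 c' χ j n 1 * Sec10C.nSum14 c' χ j (n / r) r else 0)) -
      ∑ n ∈ (Finset.Ico 1 (Nsupp D)).filter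
        (fun n : ℕ => bigP D ^ (0.498 : ℝ) ≤ (n : ℝ) ∧ (n : ℝ) < bigP D ^ (0.5 : ℝ)),
        (‖χ (n : ZMod D)‖ : ℂ) * lamZero c' D j n / (n : ℂ) * ((n : ℂ) / (Nat.totient n : ℂ)) *
          (conj iota4 * deriv χ.LFunction 1 *
              (frakfW c' D j 7 (bigP D ^ (0.5 : ℝ) / n) / ((0.5 * Real.log (bigP D) : ℝ) : ℂ)) *
            (500 * deriv χ.LFunction 1 / (Real.log (bigP D) : ℂ)) *
            (1 + fraky2 c' D j (bigP D ^ (0.004 : ℝ) * n)))‖ ≤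
      (∑ n ∈ ((Finset.Ico 1 (Nsupp D)).filter
        (fun n : ℕ => bigP D ^ (0.498 : ℝ) ≤ (n : ℝ) ∧ (n : ℝ) < bigP D ^ (0.5 : ℝ))).filter
            (fun n : ℕ => bigP D ^ (0.498 : ℝ) * ((D : ℝ) * t0 D) < (n : ℝ) ∧
              (n : ℝ) < bigP D ^ (0.5 : ℝ) / bigT D ^ 11),
          ‖(‖χ (n : ZMod D)‖ : ℂ) * lamZero c' D j n / (n : ℂ)‖ * ((n : ℝ) / Nat.totient n) ^ 3) *
          ((‖iota4‖ * ‖deriv χ.LFunction 1‖ * (29 / (0.5 * ell D ^ 9)) +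
                ‖iota4‖ * (C82 * (ell D ^ 6)⁻¹ / Real.log (Skeleton.P2 D) +
                  ‖deriv χ.LFunction 1‖ * (5000 * ell D ^ (1.1 : ℝ) * alpha D / ell D ^ 9))) *
              (C₂ * (ell D ^ 15)⁻¹ +
                ‖(500 * deriv χ.LFunction 1 / (Real.log (bigP D) : ℂ))‖ *
                  (8500 * alpha D * ell D)) +
            ‖iota4‖ * (C82 * (ell D ^ 6)⁻¹ / Real.log (Skeleton.P2 D) +
                ‖deriv χ.LFunction 1‖ * (5000 * ell D ^ (1.1 : ℝ) * alpha D / ell D ^ 9)) *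
              ‖(500 * deriv χ.LFunction 1 / (Real.log (bigP D) : ℂ))‖ * 161) +
        (∑ n ∈ ((Finset.Ico 1 (Nsupp D)).filter
        (fun n : ℕ => bigP D ^ (0.498 : ℝ) ≤ (n : ℝ) ∧ (n : ℝ) < bigP D ^ (0.5 : ℝ))).filter
            (fun n : ℕ => ¬ (bigP D ^ (0.498 : ℝ) * ((D : ℝ) * t0 D) < (n : ℝ) ∧
              (n : ℝ) < bigP D ^ (0.5 : ℝ) / bigT D ^ 11)),
          ‖(‖χ (n : ZMod D)‖ : ℂ) * lamZero c' D j n / (n : ℂ)‖ * ((n : ℝ) / Nat.totient n) ^ 3) *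
          (‖iota4‖ * (Real.log (Skeleton.P2 D))⁻¹ *
                ((1 + ell D ^ (1.1 : ℝ)) * ell D ^ (1.1 : ℝ) + 29 * ‖deriv χ.LFunction 1‖ +
                  C82 * (ell D ^ 6)⁻¹) *
              (C₃ * (ell D ^ 4)⁻¹) +
            ‖iota4‖ * ‖deriv χ.LFunction 1‖ * (29 / (0.5 * ell D ^ 9)) *
              ‖(500 * deriv χ.LFunction 1 / (Real.log (bigP D) : ℂ))‖ * 161) := by
  classical
  have hℓ : 3 ≤ ell D := by linarith
  have hℓ0 : 0 < ell D := by linarith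
  have hℓ1 : 1 ≤ ell D := by linarith
  obtain ⟨h2, hab, hb5, h5504, h504, h5P, hN⟩ := range_facts (D := D) hℓ
  obtain ⟨hα, hαeq, hαℓ9⟩ := alpha_facts (D := D) hℓ
  have hP := Real.exp_pos (ell D ^ 9)
  have hP' : 0 < bigP D := hP
  have hT := bigT_pos D
  have hT1 : 1 ≤ bigT D := by
    rw [bigT]; exact Real.one_le_exp (Real.rpow_nonneg hℓ0.le _)
  have hDt1 := Dt0_ge_one (D := D) hℓ
  have hDt0 := Dt0_pos (D := D) hℓ
  have hΛ4 : alpha D * Real.log (bigP D) ≤ 4 := by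
    rw [Sec12A.log_bigP D, hαℓ9]; linarith [Real.pi_lt_d2]
  obtain ⟨hQ1, hQP, -⟩ := sqrtP_facts (D := D) (by linarith)
  have hlogP2 := log_P2_pos (D := D) hℓ
  have hP3def : Skeleton.P3 D = bigP D ^ (0.498 : ℝ) := rfl
  have h05 : ‖((0.5 * Real.log (bigP D) : ℝ) : ℂ)‖ = 0.5 * ell D ^ 9 := by
    rw [Complex.norm_real, Sec12A.log_bigP D, Real.norm_of_nonneg (by positivity)]
  set S := (Finset.Ico 1 (Nsupp D)).filter
        (fun n : ℕ => bigP D ^ (0.498 : ℝ) ≤ (n : ℝ) ∧ (n : ℝ) < bigP D ^ (0.5 : ℝ)) with hSdef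
  have memS : ∀ n ∈ S, 1 ≤ n ∧ bigP D ^ (0.498 : ℝ) ≤ (n : ℝ) ∧ (n : ℝ) < bigP D ^ (0.5 : ℝ) := by
    intro n hn
    rw [hSdef, Finset.mem_filter, Finset.mem_Ico] at hn
    exact ⟨hn.1.1, hn.2.1, hn.2.2⟩
  have hS0 : ∀ n ∈ S, n ≠ 0 := fun n hn => by have := (memS n hn).1; omega
  have h82j : ∀ y : ℝ, bigT D < y → y < bigP D →
      ‖(∑ m ∈ Finset.Ico 1 ⌈y⌉₊, χ (m : ZMod D) / (m : ℂ) ^ (1 - betaJ c' D j) *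
            ((y / m : ℝ) : ℂ) ^ betaMu D 7 * (Real.log (y / m) : ℂ)) -
          deriv χ.LFunction 1 * frakfW c' D j 7 y‖ ≤ C82 * (ell D ^ 6)⁻¹ :=
    fun y hy1 hy2 => h82 j hj 7 (by simp) y hy1 hy2
  refine range_assembly_bound₃ hS0
    (fun n : ℕ => bigP D ^ (0.498 : ℝ) * ((D : ℝ) * t0 D) < (n : ℝ) ∧
              (n : ℝ) < bigP D ^ (0.5 : ℝ) / bigT D ^ 11)
    (fun n => (‖χ (n : ZMod D)‖ : ℂ) * lamZero c' D j n / (n : ℂ))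
    (fun n => Sec10C.mSum12 c' χ j n 1)
    (fun n => conj iota4 * deriv χ.LFunction 1 *
      (frakfW c' D j 7 (bigP D ^ (0.5 : ℝ) / n) / ((0.5 * Real.log (bigP D) : ℝ) : ℂ)))
    (fun n => 1 + fraky2 c' D j (bigP D ^ (0.004 : ℝ) * n))
    (fun d r => Sec10C.nSum14 c' χ j d r) (fun d r => PiW χ d r)
    (500 * deriv χ.LFunction 1 / (Real.log (bigP D) : ℂ))
    (by positivity) (by positivity) (by positivity) ?_ ?_ ?_ ?_ ?_ ?_ ?_
  · -- hPi: (8.10)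
    intro n hn _
    exact Section8FrontEnd810.eq810_holds D χ hq n (hS0 n hn)
  · -- hM: Lemma 8.2 in the main range + the `P₂ ↦ P^{0.5}` swap
    intro n hn hmain
    obtain ⟨-, hlo, -⟩ := memS n hn
    exact norm_mSum12_top_main_le c' χ hℓ5 hc5 j h82j hlo hmain.2
  · -- hM₀
    intro n hn
    obtain ⟨hn1, hlo, hhi⟩ := memS n hn
    have hn1r : (1 : ℝ) ≤ n := by exact_mod_cast hn1
    have hnP : (n : ℝ) ≤ bigP D := by linarith
    have hf := (Section8AbelProfiles.frakfW_div_bounds c' j 7 hα hℓ0.le hc5 hQ1 hQP hn1r hnP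
      hΛ4).2.1
    rw [norm_mul, norm_mul, RCLike.norm_conj, norm_div, h05]
    have h9 : 0 < 0.5 * ell D ^ 9 := by positivity
    exact mul_le_mul_of_nonneg_left (div_le_div_of_nonneg_right hf h9.le) (by positivity)
  · -- hMW: crude `m`-side bound
    intro n hn _
    obtain ⟨-, hlo, hhi⟩ := memS n hn
    exact norm_mSum12_top_crude_le c' χ hℓ5 hc5 j hC82 h82j hlo hhi
  · -- hG: `‖1 + 𝔶₂ⱼ(P^{0.004}n)‖ ≤ 161`
    intro n hn
    obtain ⟨hn1, -, hhi⟩ := memS n hn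
    have hn1r : (1 : ℝ) ≤ n := by exact_mod_cast hn1
    have hnP : (n : ℝ) ≤ bigP D := by linarith
    exact (y2Profile_bounds c' j hα hℓ0.le hc5 hn1r hnP hΛ4 hQ1 hQP).2.1
  · -- hN: the shifted (10.10)ᴿ in the main range + the `y* ↦ P^{0.004}n` swap in `𝔶₂ⱼ`
    intro n hn hmain r hr hsq
    obtain ⟨hn1, hlo, hhi⟩ := memS n hn
    have hrd : r ∣ n := Nat.dvd_of_mem_divisors hr
    have hr0 : r ≠ 0 := Nat.pos_iff_ne_zero.mp (Nat.pos_of_mem_divisors hr)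
    have hr1 : 1 ≤ r := Nat.one_le_iff_ne_zero.mpr hr0
    have hdr : n / r * r = n := Nat.div_mul_cancel hrd
    have hd0 : n / r ≠ 0 := (Nat.div_pos (Nat.le_of_dvd (by omega) hrd) (by omega)).ne'
    have hd1 : 1 ≤ n / r := Nat.one_le_iff_ne_zero.mpr hd0
    have hcast : ((n / r * r : ℕ) : ℝ) = n := by rw [hdr]
    have hn0r : (0 : ℝ) < n := by exact_mod_cast (by omega : 0 < n)
    -- position of `y* = nP^{0.004}/(Dt₀)`
    have hys : yShift D (n : ℝ) = (n : ℝ) * bigP D ^ (0.004 : ℝ) / ((D : ℝ) * t0 D) := rfl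
    have h004 : 0 < bigP D ^ (0.004 : ℝ) := Real.rpow_pos_of_pos hP' _
    have h502 : bigP D ^ (0.498 : ℝ) * bigP D ^ (0.004 : ℝ) = bigP D ^ (0.502 : ℝ) := by
      rw [← Real.rpow_add hP']; norm_num
    have h504 : bigP D ^ (0.5 : ℝ) * bigP D ^ (0.004 : ℝ) = bigP D ^ (0.504 : ℝ) := by
      rw [← Real.rpow_add hP']; norm_num
    have hyslo : bigP D ^ (0.502 : ℝ) < yShift D (n : ℝ) := by
      rw [hys, lt_div_iff₀ hDt0, ← h502]
      have h1 : bigP D ^ (0.498 : ℝ) * ((D : ℝ) * t0 D) < n := hmain.1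
      nlinarith
    have hyshi : yShift D (n : ℝ) ≤ bigP D ^ (0.504 : ℝ) / bigT D := by
      rw [hys, div_le_iff₀ hDt0, ← h504]
      have h1 : (n : ℝ) < bigP D ^ (0.5 : ℝ) / bigT D ^ 11 := hmain.2
      rw [lt_div_iff₀ (pow_pos hT 11)] at h1
      have hT11 : bigT D ≤ bigT D ^ 11 := le_self_pow₀ hT1 (by norm_num)
      have hnT : (n : ℝ) * bigT D ≤ bigP D ^ (0.5 : ℝ) := by nlinarith
      calc (n : ℝ) * bigP D ^ (0.004 : ℝ) = (n : ℝ) * bigT D * bigP D ^ (0.004 : ℝ) / bigT D := by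
            field_simp
        _ ≤ bigP D ^ (0.5 : ℝ) * bigP D ^ (0.004 : ℝ) / bigT D := by gcongr
        _ ≤ bigP D ^ (0.5 : ℝ) * bigP D ^ (0.004 : ℝ) / bigT D * ((D : ℝ) * t0 D) :=
            le_mul_of_one_le_right (by positivity) hDt1
    have key := h10S j hj (n / r) r hd1 hr1 (by rw [hcast]; exact hyslo) (by rw [hcast]; exact hyshi)
    rw [hcast] at key
    have hbridge : Sec10C.nSum14 c' χ j (n / r) r = frakv2S c' χ j (n / r) r :=
      Sec10C.nSum14_eq_frakv2S c' χ hℓ j hd1 hr1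
    have hR : (∏ q ∈ (n / r * r).primeFactors, (1 - (q : ℝ)⁻¹)⁻¹) ^ 2 =
        ((n : ℝ) / Nat.totient n) ^ 2 := by rw [hdr]; exact Sj1321Mid.prod_one_sub_inv_inv_sq_eq (by omega)
    have hPi : ‖PiW χ (n / r) r‖ ≤ ((n : ℝ) / Nat.totient n) ^ 2 := by
      rw [← hR]; exact Lemma84.norm_PiW_le_prodInv χ hd0 hr0
    have hyy := norm_fraky2_yShift_sub_le c' hℓ hc5 j (hab.trans hlo) hhi.le
    rw [hR] at key
    set c₀ : ℂ := 500 * deriv χ.LFunction 1 / (Real.log (bigP D) : ℂ) with hc₀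
    have e : Sec10C.nSum14 c' χ j (n / r) r -
        c₀ * PiW χ (n / r) r * (1 + fraky2 c' D j (bigP D ^ (0.004 : ℝ) * n)) =
      (frakv2S c' χ j (n / r) r - 500 * deriv χ.LFunction 1 * PiW χ (n / r) r /
          (Real.log (bigP D) : ℂ) * (1 + fraky2 c' D j (yShift D (n : ℝ)))) +
        c₀ * PiW χ (n / r) r *
          (fraky2 c' D j (yShift D (n : ℝ)) - fraky2 c' D j (bigP D ^ (0.004 : ℝ) * n)) := by
      rw [hbridge, hc₀]; ring
    rw [e]
    calc _ ≤ ‖frakv2S c' χ j (n / r) r - 500 * deriv χ.LFunction 1 * PiW χ (n / r) r /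
            (Real.log (bigP D) : ℂ) * (1 + fraky2 c' D j (yShift D (n : ℝ)))‖ +
          ‖c₀ * PiW χ (n / r) r *
            (fraky2 c' D j (yShift D (n : ℝ)) - fraky2 c' D j (bigP D ^ (0.004 : ℝ) * n))‖ :=
          norm_add_le _ _
      _ ≤ C₂ * (ell D ^ 15)⁻¹ * ((n : ℝ) / Nat.totient n) ^ 2 +
          ‖c₀‖ * ((n : ℝ) / Nat.totient n) ^ 2 * (8500 * alpha D * ell D) := by
          refine add_le_add key ?_
          rw [norm_mul, norm_mul]
          gcongr
      _ = (C₂ * (ell D ^ 15)⁻¹ + ‖c₀‖ * (8500 * alpha D * ell D)) *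
          ((n : ℝ) / Nat.totient n) ^ 2 := by ring
  · -- hW: the weak window bound for the shifted `𝔳₂ⱼ`-sum
    intro n hn _ r hr hsq
    obtain ⟨hn1, hlo, hhi⟩ := memS n hn
    have hrd : r ∣ n := Nat.dvd_of_mem_divisors hr
    have hr0 : r ≠ 0 := Nat.pos_iff_ne_zero.mp (Nat.pos_of_mem_divisors hr)
    have hr1 : 1 ≤ r := Nat.one_le_iff_ne_zero.mpr hr0
    have hdr : n / r * r = n := Nat.div_mul_cancel hrd
    have hd1 : 1 ≤ n / r := Nat.div_pos (Nat.le_of_dvd (by omega) hrd) (by omega)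
    have hcast : ((n / r * r : ℕ) : ℝ) = n := by rw [hdr]
    have key := hWN j hj (n / r) r hd1 hr1 (by rw [hcast]; exact hhi)
    have hR : (∏ q ∈ (n / r * r).primeFactors, (1 - (q : ℝ)⁻¹)⁻¹) ^ 2 =
        ((n : ℝ) / Nat.totient n) ^ 2 := by rw [hdr]; exact Sj1321Mid.prod_one_sub_inv_inv_sq_eq (by omega)
    rw [hR] at key
    rw [Sec10C.nSum14_eq_frakv2S c' χ hℓ j hd1 hr1]
    exact key

/-- **Top range, the collapsed main term IS the printed `n`-sum `topSum1214`.**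
[cite: Zhang2022LandauSiegel, §10 p. 61] -/
theorem top1214_mainterm_eq (hℓ : 3 ≤ ell D) (j : ℕ) :
    ∑ n ∈ (Finset.Ico 1 (Nsupp D)).filter
        (fun n : ℕ => bigP D ^ (0.498 : ℝ) ≤ (n : ℝ) ∧ (n : ℝ) < bigP D ^ (0.5 : ℝ)),
        (‖χ (n : ZMod D)‖ : ℂ) * lamZero c' D j n / (n : ℂ) * ((n : ℂ) / (Nat.totient n : ℂ)) *
          (conj iota4 * deriv χ.LFunction 1 *
              (frakfW c' D j 7 (bigP D ^ (0.5 : ℝ) / n) / ((0.5 * Real.log (bigP D) : ℝ) : ℂ)) *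
            (500 * deriv χ.LFunction 1 / (Real.log (bigP D) : ℂ)) *
            (1 + fraky2 c' D j (bigP D ^ (0.004 : ℝ) * n))) =
      topSum1214 c' χ j := by
  rw [topSet_eq hℓ]
  unfold topSum1214 lamAvg
  rw [Finset.mul_sum]
  refine Finset.sum_congr rfl fun n hn => ?_
  obtain ⟨h2, hab, -⟩ := range_facts (D := D) hℓ
  have hℓ0 : 0 < ell D := by linarith
  have hn1 : 1 ≤ n := by
    have := (Finset.mem_Ico.mp hn).1
    have : (2 : ℝ) ≤ ⌈bigP D ^ (0.498 : ℝ)⌉₊ := (h2.trans hab).trans (Nat.le_ceil _)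
    have : 2 ≤ ⌈bigP D ^ (0.498 : ℝ)⌉₊ := by exact_mod_cast this
    omega
  have hn0 : (n : ℂ) ≠ 0 := by exact_mod_cast (by omega : n ≠ 0)
  have hΛ : (Real.log (bigP D) : ℂ) ≠ 0 := by
    rw [Sec12A.log_bigP D]; exact_mod_cast (by positivity : ell D ^ 9 ≠ 0)
  have h05 : ((0.5 * Real.log (bigP D) : ℝ) : ℂ) = (Real.log (bigP D) : ℂ) / 2 := by
    push_cast; ring
  rw [h05]
  field_simp
  ring

end Assembly

/-! ## The numerical core and the top range at a fixed modulus -/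

section Numeric

/-- Elementary: for `3 ≤ ℓ ≤ τ`, `τ/ℓ¹³ ≤ τ⁵/ℓ¹⁵` and `τ³/ℓ¹³ ≤ τ⁵/ℓ¹⁵`. [folklore] -/
private theorem tau_pow_facts {ℓ τ : ℝ} (h3 : 3 ≤ ℓ) (hτ : ℓ ≤ τ) :
    τ / ℓ ^ 13 ≤ τ ^ 5 / ℓ ^ 15 ∧ τ ^ 3 / ℓ ^ 13 ≤ τ ^ 5 / ℓ ^ 15 := by
  have hℓ0 : 0 < ℓ := by linarith
  have hτ0 : 0 < τ := by linarith
  have hτ1 : 1 ≤ τ := by linarith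
  have hℓτ2 : ℓ ^ 2 ≤ τ ^ 2 := pow_le_pow_left₀ hℓ0.le hτ 2
  have hτ24 : τ ^ 2 ≤ τ ^ 4 := pow_le_pow_right₀ hτ1 (by norm_num)
  constructor
  · rw [div_le_div_iff₀ (by positivity) (by positivity)]
    calc τ * ℓ ^ 15 = τ * ℓ ^ 2 * ℓ ^ 13 := by ring
      _ ≤ τ * τ ^ 4 * ℓ ^ 13 := by gcongr; exact hℓτ2.trans hτ24
      _ = τ ^ 5 * ℓ ^ 13 := by ring
  · rw [div_le_div_iff₀ (by positivity) (by positivity)]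
    calc τ ^ 3 * ℓ ^ 15 = τ ^ 3 * ℓ ^ 2 * ℓ ^ 13 := by ring
      _ ≤ τ ^ 3 * τ ^ 2 * ℓ ^ 13 := by gcongr
      _ = τ ^ 5 * ℓ ^ 13 := by ring

/-- **The numerical core of the top range.** If the tolerances of the assembly satisfy
`BM ≤ a₁ℓ⁻⁷`, `eM ≤ a₂τℓ⁻¹⁵`, `eN ≤ a₃ℓ⁻¹⁵`, `‖c₀‖ ≤ a₄ℓ⁻⁷`, `BG ≤ 161`, `BW ≤ a₅τ²ℓ⁻⁹`,
`eW ≤ a₆ℓ⁻⁴` and the weights `Wm ≤ e²⁵⁶ℓ⁹`, `Ww ≤ 537e²⁵⁶τ` (`3 ≤ ℓ ≤ τ`), then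
`Wm((BM+eM)eN + eM‖c₀‖BG) + Ww(BW·eW + BM‖c₀‖BG) ≤ e²⁵⁶((a₁+a₂)a₃ + 161a₂a₄ + 537(a₅a₆ + 161a₁a₄))τ⁵ℓ⁻¹⁵`.
[cite: Zhang2022LandauSiegel, §10 p. 61] -/
theorem numeric_core {ℓ τ Wm Ww BM eM eN c0n BG BW eW a₁ a₂ a₃ a₄ a₅ a₆ : ℝ} (h3 : 3 ≤ ℓ)
    (hτ : ℓ ≤ τ) (hBM0 : 0 ≤ BM) (heM0 : 0 ≤ eM) (heN0 : 0 ≤ eN)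
    (hc00 : 0 ≤ c0n) (hBG0 : 0 ≤ BG) (hBW0 : 0 ≤ BW) (heW0 : 0 ≤ eW)
    (ha₁ : 0 ≤ a₁) (ha₂ : 0 ≤ a₂) (ha₃ : 0 ≤ a₃) (ha₄ : 0 ≤ a₄) (ha₅ : 0 ≤ a₅) (ha₆ : 0 ≤ a₆)
    (hBM : BM ≤ a₁ / ℓ ^ 7) (heM : eM ≤ a₂ * τ / ℓ ^ 15) (heN : eN ≤ a₃ / ℓ ^ 15)
    (hc0 : c0n ≤ a₄ / ℓ ^ 7) (hBG : BG ≤ 161) (hBW : BW ≤ a₅ * τ ^ 2 / ℓ ^ 9) (heW : eW ≤ a₆ / ℓ ^ 4)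
    (hWm : Wm ≤ Real.exp 256 * ℓ ^ 9) (hWw : Ww ≤ 537 * Real.exp 256 * τ) :
    Wm * ((BM + eM) * eN + eM * c0n * BG) + Ww * (BW * eW + BM * c0n * BG) ≤
      Real.exp 256 * ((a₁ + a₂) * a₃ + 161 * a₂ * a₄ + 537 * (a₅ * a₆ + 161 * a₁ * a₄)) *
        τ ^ 5 * (ℓ ^ 15)⁻¹ := by
  have hℓ0 : 0 < ℓ := by linarith
  have hℓ1 : 1 ≤ ℓ := by linarith
  have hτ1 : 1 ≤ τ := by linarith
  have hτ0 : 0 < τ := by linarith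
  obtain ⟨hp1, hp3⟩ := tau_pow_facts h3 hτ
  have he := Real.exp_pos 256
  -- monomial comparisons
  have m1 : a₁ / ℓ ^ 7 ≤ a₁ * τ / ℓ ^ 7 := by
    rw [div_le_div_iff_of_pos_right (by positivity)]; nlinarith
  have m2 : a₂ * τ / ℓ ^ 15 ≤ a₂ * τ / ℓ ^ 7 := by
    apply div_le_div_of_nonneg_left (by positivity) (by positivity)
    exact pow_le_pow_right₀ hℓ1 (by norm_num)
  have hBMeM : BM + eM ≤ (a₁ + a₂) * τ / ℓ ^ 7 := by
    have := add_le_add (hBM.trans m1) (heM.trans m2)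
    have e : (a₁ + a₂) * τ / ℓ ^ 7 = a₁ * τ / ℓ ^ 7 + a₂ * τ / ℓ ^ 7 := by ring
    rw [e]; exact this
  -- X ≤ Kx τ / ℓ^22
  have hX : (BM + eM) * eN + eM * c0n * BG ≤
      ((a₁ + a₂) * a₃ + 161 * a₂ * a₄) * τ / ℓ ^ 22 := by
    have t1 : (BM + eM) * eN ≤ ((a₁ + a₂) * τ / ℓ ^ 7) * (a₃ / ℓ ^ 15) :=
      mul_le_mul hBMeM heN heN0 (by positivity)
    have t2 : eM * c0n * BG ≤ (a₂ * τ / ℓ ^ 15) * (a₄ / ℓ ^ 7) * 161 :=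
      mul_le_mul (mul_le_mul heM hc0 hc00 (by positivity)) hBG hBG0 (by positivity)
    calc (BM + eM) * eN + eM * c0n * BG
        ≤ ((a₁ + a₂) * τ / ℓ ^ 7) * (a₃ / ℓ ^ 15) + (a₂ * τ / ℓ ^ 15) * (a₄ / ℓ ^ 7) * 161 :=
          add_le_add t1 t2
      _ = ((a₁ + a₂) * a₃ + 161 * a₂ * a₄) * τ / ℓ ^ 22 := by
          field_simp
  -- Y ≤ Ky τ² / ℓ^13
  have m3 : a₁ / ℓ ^ 7 * (a₄ / ℓ ^ 7) * 161 ≤ 161 * a₁ * a₄ * τ ^ 2 / ℓ ^ 13 := by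
    have e1 : a₁ / ℓ ^ 7 * (a₄ / ℓ ^ 7) * 161 = 161 * a₁ * a₄ / ℓ ^ 14 := by
      field_simp
    rw [e1, div_le_div_iff₀ (by positivity) (by positivity)]
    have : ℓ ^ 13 ≤ τ ^ 2 * ℓ ^ 14 / ℓ := by
      rw [le_div_iff₀ hℓ0]
      have hτ2 : 1 ≤ τ ^ 2 := one_le_pow₀ hτ1
      nlinarith [pow_pos hℓ0 14]
    have h0 : 0 ≤ 161 * a₁ * a₄ := by positivity
    calc 161 * a₁ * a₄ * ℓ ^ 13 ≤ 161 * a₁ * a₄ * (τ ^ 2 * ℓ ^ 14 / ℓ) :=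
          mul_le_mul_of_nonneg_left this h0
      _ = 161 * a₁ * a₄ * τ ^ 2 * ℓ ^ 14 / ℓ := by ring
      _ ≤ 161 * a₁ * a₄ * τ ^ 2 * ℓ ^ 14 := div_le_self (by positivity) hℓ1
  have hY : BW * eW + BM * c0n * BG ≤ (a₅ * a₆ + 161 * a₁ * a₄) * τ ^ 2 / ℓ ^ 13 := by
    have t1 : BW * eW ≤ (a₅ * τ ^ 2 / ℓ ^ 9) * (a₆ / ℓ ^ 4) :=
      mul_le_mul hBW heW heW0 (by positivity)
    have t2 : BM * c0n * BG ≤ (a₁ / ℓ ^ 7) * (a₄ / ℓ ^ 7) * 161 :=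
      mul_le_mul (mul_le_mul hBM hc0 hc00 (by positivity)) hBG hBG0 (by positivity)
    calc BW * eW + BM * c0n * BG
        ≤ (a₅ * τ ^ 2 / ℓ ^ 9) * (a₆ / ℓ ^ 4) + 161 * a₁ * a₄ * τ ^ 2 / ℓ ^ 13 :=
          add_le_add t1 (t2.trans m3)
      _ = (a₅ * a₆ + 161 * a₁ * a₄) * τ ^ 2 / ℓ ^ 13 := by
          field_simp
  have hX0 : 0 ≤ (BM + eM) * eN + eM * c0n * BG := by positivity
  have hY0 : 0 ≤ BW * eW + BM * c0n * BG := by positivity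
  set Kx : ℝ := (a₁ + a₂) * a₃ + 161 * a₂ * a₄ with hKx
  set Ky : ℝ := a₅ * a₆ + 161 * a₁ * a₄ with hKy
  have hKx0 : 0 ≤ Kx := by positivity
  have hKy0 : 0 ≤ Ky := by positivity
  calc Wm * ((BM + eM) * eN + eM * c0n * BG) + Ww * (BW * eW + BM * c0n * BG)
      ≤ (Real.exp 256 * ℓ ^ 9) * (Kx * τ / ℓ ^ 22) + (537 * Real.exp 256 * τ) * (Ky * τ ^ 2 / ℓ ^ 13) :=
        add_le_add (mul_le_mul hWm hX hX0 (by positivity)) (mul_le_mul hWw hY hY0 (by positivity))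
    _ = Real.exp 256 * (Kx * (τ / ℓ ^ 13) + 537 * Ky * (τ ^ 3 / ℓ ^ 13)) := by
        field_simp
    _ ≤ Real.exp 256 * (Kx * (τ ^ 5 / ℓ ^ 15) + 537 * Ky * (τ ^ 5 / ℓ ^ 15)) := by
        gcongr
    _ = Real.exp 256 * ((a₁ + a₂) * a₃ + 161 * a₂ * a₄ + 537 * (a₅ * a₆ + 161 * a₁ * a₄)) *
        τ ^ 5 * (ℓ ^ 15)⁻¹ := by
        rw [hKx, hKy]; field_simp

end Numeric

section Final

variable (c' : ℝ) {D : ℕ} [NeZero D] (χ : DirichletCharacter ℂ D)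

set_option maxHeartbeats 400000 in
-- a long chain of explicit-constant estimates at a fixed modulus; modest margin over the default
/-- **The top range at a fixed modulus** [cite: Zhang2022LandauSiegel, §10 p. 61 (u057 (i))]:
under the bodies of Lemma 8.2, the shifted (10.10)ᴿ and the weak window bound for the shifted
`𝔳₂ⱼ`-sum, for `𝓛 ≥ 5` and `5|c′|α𝓛 ≤ 1`,
`|S_{12,14}[P^{0.498},P^{0.5}) − topSum1214| ≤ K(C₈₂⁺,C₂⁺,C₃⁺)·(𝓛^{1.1})⁵·𝓛⁻¹⁵`. -/
theorem top1214_at (hℓ5 : 5 ≤ ell D) (hq : χ.IsQuadratic) (hp : χ.IsPrimitive)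
    (hc5 : 5 * |c'| * alpha D * ell D ≤ 1) {C82 C₂ C₃ : ℝ} (hC82 : 0 ≤ C82) (hC₂ : 0 ≤ C₂)
    (hC₃ : 0 ≤ C₃)
    (h82 : ∀ j ∈ ({1, 2, 3} : Finset ℕ), ∀ μ ∈ ({6, 7} : Finset ℕ), ∀ y : ℝ, bigT D < y →
      y < bigP D →
      ‖(∑ m ∈ Finset.Ico 1 ⌈y⌉₊, χ (m : ZMod D) / (m : ℂ) ^ (1 - betaJ c' D j) *
            ((y / m : ℝ) : ℂ) ^ betaMu D μ * (Real.log (y / m) : ℂ)) -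
          deriv χ.LFunction 1 * frakfW c' D j μ y‖ ≤ C82 * (ell D ^ 6)⁻¹)
    (h10S : ∀ j ∈ ({1, 2, 3} : Finset ℕ), ∀ d r : ℕ, 1 ≤ d → 1 ≤ r →
      bigP D ^ (0.502 : ℝ) < yShift D ((d * r : ℕ) : ℝ) →
      yShift D ((d * r : ℕ) : ℝ) ≤ bigP D ^ (0.504 : ℝ) / bigT D →
        ‖frakv2S c' χ j d r - 500 * deriv χ.LFunction 1 * PiW χ d r / Real.log (bigP D) *
            (1 + fraky2 c' D j (yShift D ((d * r : ℕ) : ℝ)))‖ ≤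
          C₂ * (ell D ^ 15)⁻¹ * (∏ q ∈ (d * r).primeFactors, (1 - (q : ℝ)⁻¹)⁻¹) ^ 2)
    (hWN : ∀ j ∈ ({1, 2, 3} : Finset ℕ), ∀ d r : ℕ, 1 ≤ d → 1 ≤ r →
      ((d * r : ℕ) : ℝ) < bigP D ^ (0.5 : ℝ) →
        ‖frakv2S c' χ j d r‖ ≤
          C₃ * (ell D ^ 4)⁻¹ * (∏ q ∈ (d * r).primeFactors, (1 - (q : ℝ)⁻¹)⁻¹) ^ 2)
    {j : ℕ} (hj : j ∈ ({1, 2, 3} : Finset ℕ)) :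
    ‖S1214On c' χ j (bigP D ^ (0.498 : ℝ)) (bigP D ^ (0.5 : ℝ)) - topSum1214 c' χ j‖ ≤
      Real.exp 256 *
          ((534 * Real.exp (9 / 2) + (5.75 * C82 + 46000 * π * Real.exp (9 / 2))) *
              (C₂ + 17000000 * π * Real.exp (9 / 2)) +
            161 * (5.75 * C82 + 46000 * π * Real.exp (9 / 2)) * (2000 * Real.exp (9 / 2)) +
            537 * ((5.75 * (2 + 116 * Real.exp (9 / 2) + C82)) * C₃ +
              161 * (534 * Real.exp (9 / 2)) * (2000 * Real.exp (9 / 2)))) *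
        (ell D ^ (1.1 : ℝ)) ^ 5 * (ell D ^ 15)⁻¹ := by
  classical
  have hℓ : 3 ≤ ell D := by linarith
  have hℓ1 : 1 ≤ ell D := by linarith
  have hℓ0 : 0 < ell D := by linarith
  obtain ⟨-, -, -, h5504, -, -, hN⟩ := range_facts (D := D) hℓ
  obtain ⟨hα, hαeq, hαℓ9⟩ := alpha_facts (D := D) hℓ
  have hA := top1214_assembly_le c' χ hℓ5 hq hc5 hC82 h82 h10S hWN hj
  have hB := top1214_mainterm_eq c' χ hℓ j
  rw [hB] at hA
  rw [S1214On_eq_divisor_sum c' χ j (fun n hn => hN n (hn.trans_le h5504))]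
  refine hA.trans ?_
  -- the sizes at this modulus
  have hτ : ell D ≤ ell D ^ (1.1 : ℝ) := by
    calc ell D = ell D ^ (1 : ℝ) := (Real.rpow_one _).symm
      _ ≤ ell D ^ (1.1 : ℝ) := Real.rpow_le_rpow_of_exponent_le hℓ1 (by norm_num)
  have hτ1 : 1 ≤ ell D ^ (1.1 : ℝ) := le_trans hℓ1 hτ
  have hτ0 : 0 ≤ ell D ^ (1.1 : ℝ) := by linarith
  have hL := norm_deriv_L_one_le χ hℓ hp
  have hL0 := norm_nonneg (deriv χ.LFunction 1)
  obtain ⟨-, hi4⟩ := norm_iota34_le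
  have hi40 := norm_nonneg iota4
  obtain ⟨hl2lo, -⟩ := log_P2_bounds (D := D) hℓ
  have hl2 : 0 < Real.log (Skeleton.P2 D) := by
    have : 0 < 0.4 * ell D ^ 9 := by positivity
    linarith
  have he := Real.exp_pos (9 / 2)
  -- ‖c₀‖ = 500‖L′‖/𝓛⁹
  have hc0eq : ‖(500 * deriv χ.LFunction 1 / (Real.log (bigP D) : ℂ))‖ =
      500 * ‖deriv χ.LFunction 1‖ / ell D ^ 9 := by
    rw [norm_div, norm_mul, Complex.norm_real, Sec12A.log_bigP D, Real.norm_of_nonneg (by positivity)]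
    norm_num
  -- weights
  have h9 : 3 + 0.002 * ell D ^ 9 ≤ ell D ^ 9 := by
    have : (3 : ℝ) ^ 9 ≤ ell D ^ 9 := pow_le_pow_left₀ (by norm_num) hℓ 9
    nlinarith
  have hWa := (top_weights_all_le c' χ hℓ j).trans
    (mul_le_mul_of_nonneg_left h9 (Real.exp_pos _).le)
  have hWw : _ ≤ 537 * Real.exp 256 * ell D ^ (1.1 : ℝ) :=
    (top_weights_window_le c' χ hℓ j).trans (by nlinarith [Real.exp_pos 256])
  have hWm : (∑ n ∈ ((Finset.Ico 1 (Nsupp D)).filter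
        (fun n : ℕ => bigP D ^ (0.498 : ℝ) ≤ (n : ℝ) ∧ (n : ℝ) < bigP D ^ (0.5 : ℝ))).filter
          (fun n : ℕ => bigP D ^ (0.498 : ℝ) * ((D : ℝ) * t0 D) < (n : ℝ) ∧
              (n : ℝ) < bigP D ^ (0.5 : ℝ) / bigT D ^ 11),
        ‖(‖χ (n : ZMod D)‖ : ℂ) * lamZero c' D j n / (n : ℂ)‖ * ((n : ℝ) / Nat.totient n) ^ 3) ≤
      Real.exp 256 * ell D ^ 9 :=
    (Finset.sum_le_sum_of_subset_of_nonneg (Finset.filter_subset _ _)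
      (fun n _ _ => by positivity)).trans hWa
  -- the tolerances as monomials in `𝓛` and `τ = 𝓛^{1.1}`
  have hBM : ‖iota4‖ * ‖deriv χ.LFunction 1‖ * (29 / (0.5 * ell D ^ 9)) ≤
      534 * Real.exp (9 / 2) / ell D ^ 7 := by
    have : ‖iota4‖ * ‖deriv χ.LFunction 1‖ ≤ 2.3 * (4 * Real.exp (9 / 2) * ell D ^ 2) :=
      mul_le_mul hi4 hL hL0 (by norm_num)
    calc ‖iota4‖ * ‖deriv χ.LFunction 1‖ * (29 / (0.5 * ell D ^ 9))
        ≤ 2.3 * (4 * Real.exp (9 / 2) * ell D ^ 2) * (29 / (0.5 * ell D ^ 9)) := by gcongr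
      _ = 533.6 * Real.exp (9 / 2) / ell D ^ 7 := by field_simp; ring
      _ ≤ 534 * Real.exp (9 / 2) / ell D ^ 7 := by gcongr; norm_num
  have heM : ‖iota4‖ * (C82 * (ell D ^ 6)⁻¹ / Real.log (Skeleton.P2 D) +
        ‖deriv χ.LFunction 1‖ * (5000 * ell D ^ (1.1 : ℝ) * alpha D / ell D ^ 9)) ≤
      (5.75 * C82 + 46000 * π * Real.exp (9 / 2)) * ell D ^ (1.1 : ℝ) / ell D ^ 15 := by
    have t1 : C82 * (ell D ^ 6)⁻¹ / Real.log (Skeleton.P2 D) ≤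
        C82 * (ell D ^ 6)⁻¹ / (0.4 * ell D ^ 9) :=
      div_le_div_of_nonneg_left (by positivity) (by positivity) hl2lo
    have t2 : ‖deriv χ.LFunction 1‖ * (5000 * ell D ^ (1.1 : ℝ) * alpha D / ell D ^ 9) ≤
        (4 * Real.exp (9 / 2) * ell D ^ 2) * (5000 * ell D ^ (1.1 : ℝ) * alpha D / ell D ^ 9) :=
      mul_le_mul_of_nonneg_right hL (by positivity)
    calc _ ≤ 2.3 * (C82 * (ell D ^ 6)⁻¹ / (0.4 * ell D ^ 9) +
          (4 * Real.exp (9 / 2) * ell D ^ 2) * (5000 * ell D ^ (1.1 : ℝ) * alpha D / ell D ^ 9)) :=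
          mul_le_mul hi4 (add_le_add t1 t2) (by positivity) (by norm_num)
      _ = 5.75 * C82 / ell D ^ 15 +
          46000 * π * Real.exp (9 / 2) * ell D ^ (1.1 : ℝ) / ell D ^ 16 := by
          rw [hαeq]; field_simp; ring
      _ ≤ 5.75 * C82 * ell D ^ (1.1 : ℝ) / ell D ^ 15 +
          46000 * π * Real.exp (9 / 2) * ell D ^ (1.1 : ℝ) / ell D ^ 15 := by
          apply add_le_add
          · rw [div_le_div_iff_of_pos_right (by positivity)]
            exact le_mul_of_one_le_right (by positivity) hτ1
          · apply div_le_div_of_nonneg_left (by positivity) (by positivity)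
            exact pow_le_pow_right₀ hℓ1 (by norm_num)
      _ = (5.75 * C82 + 46000 * π * Real.exp (9 / 2)) * ell D ^ (1.1 : ℝ) / ell D ^ 15 := by
          ring
  have hc0 : ‖(500 * deriv χ.LFunction 1 / (Real.log (bigP D) : ℂ))‖ ≤
      2000 * Real.exp (9 / 2) / ell D ^ 7 := by
    rw [hc0eq, div_le_div_iff₀ (by positivity) (by positivity)]
    calc 500 * ‖deriv χ.LFunction 1‖ * ell D ^ 7
        ≤ 500 * (4 * Real.exp (9 / 2) * ell D ^ 2) * ell D ^ 7 := by gcongr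
      _ = 2000 * Real.exp (9 / 2) * ell D ^ 9 := by ring
  have heN : C₂ * (ell D ^ 15)⁻¹ +
        ‖(500 * deriv χ.LFunction 1 / (Real.log (bigP D) : ℂ))‖ * (8500 * alpha D * ell D) ≤
      (C₂ + 17000000 * π * Real.exp (9 / 2)) / ell D ^ 15 := by
    calc C₂ * (ell D ^ 15)⁻¹ +
          ‖(500 * deriv χ.LFunction 1 / (Real.log (bigP D) : ℂ))‖ * (8500 * alpha D * ell D)
        ≤ C₂ * (ell D ^ 15)⁻¹ + (2000 * Real.exp (9 / 2) / ell D ^ 7) * (8500 * alpha D * ell D) := by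
          gcongr
      _ = (C₂ + 17000000 * π * Real.exp (9 / 2)) / ell D ^ 15 := by
          rw [hαeq]; field_simp; ring
  have hBW : ‖iota4‖ * (Real.log (Skeleton.P2 D))⁻¹ *
        ((1 + ell D ^ (1.1 : ℝ)) * ell D ^ (1.1 : ℝ) + 29 * ‖deriv χ.LFunction 1‖ +
          C82 * (ell D ^ 6)⁻¹) ≤
      5.75 * (2 + 116 * Real.exp (9 / 2) + C82) * (ell D ^ (1.1 : ℝ)) ^ 2 / ell D ^ 9 := by
    have hℓτ2 : ell D ^ 2 ≤ (ell D ^ (1.1 : ℝ)) ^ 2 := pow_le_pow_left₀ hℓ0.le hτ 2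
    have hτ2 : 1 ≤ (ell D ^ (1.1 : ℝ)) ^ 2 := one_le_pow₀ hτ1
    have hinner : (1 + ell D ^ (1.1 : ℝ)) * ell D ^ (1.1 : ℝ) + 29 * ‖deriv χ.LFunction 1‖ +
        C82 * (ell D ^ 6)⁻¹ ≤ (2 + 116 * Real.exp (9 / 2) + C82) * (ell D ^ (1.1 : ℝ)) ^ 2 := by
      have a1 : (1 + ell D ^ (1.1 : ℝ)) * ell D ^ (1.1 : ℝ) ≤ 2 * (ell D ^ (1.1 : ℝ)) ^ 2 := by
        nlinarith
      have a2 : 29 * ‖deriv χ.LFunction 1‖ ≤ 116 * Real.exp (9 / 2) * (ell D ^ (1.1 : ℝ)) ^ 2 := by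
        calc 29 * ‖deriv χ.LFunction 1‖ ≤ 29 * (4 * Real.exp (9 / 2) * ell D ^ 2) := by gcongr
          _ = 116 * Real.exp (9 / 2) * ell D ^ 2 := by ring
          _ ≤ 116 * Real.exp (9 / 2) * (ell D ^ (1.1 : ℝ)) ^ 2 := by gcongr
      have a3 : C82 * (ell D ^ 6)⁻¹ ≤ C82 * (ell D ^ (1.1 : ℝ)) ^ 2 := by
        have h6 : (ell D ^ 6)⁻¹ ≤ 1 := inv_le_one_of_one_le₀ (one_le_pow₀ hℓ1)
        calc C82 * (ell D ^ 6)⁻¹ ≤ C82 * 1 := by gcongr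
          _ ≤ C82 * (ell D ^ (1.1 : ℝ)) ^ 2 := by gcongr
      nlinarith
    have hinv : (Real.log (Skeleton.P2 D))⁻¹ ≤ (0.4 * ell D ^ 9)⁻¹ :=
      inv_anti₀ (by positivity) hl2lo
    have hin0 : 0 ≤ (1 + ell D ^ (1.1 : ℝ)) * ell D ^ (1.1 : ℝ) + 29 * ‖deriv χ.LFunction 1‖ +
        C82 * (ell D ^ 6)⁻¹ := by positivity
    calc _ ≤ 2.3 * (0.4 * ell D ^ 9)⁻¹ *
          ((2 + 116 * Real.exp (9 / 2) + C82) * (ell D ^ (1.1 : ℝ)) ^ 2) :=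
          mul_le_mul (mul_le_mul hi4 hinv (by positivity) (by norm_num)) hinner hin0
            (by positivity)
      _ = 5.75 * (2 + 116 * Real.exp (9 / 2) + C82) * (ell D ^ (1.1 : ℝ)) ^ 2 / ell D ^ 9 := by
          field_simp; ring
  have heW : C₃ * (ell D ^ 4)⁻¹ ≤ C₃ / ell D ^ 4 := by rw [div_eq_mul_inv]
  have hmain := numeric_core (ℓ := ell D) (τ := ell D ^ (1.1 : ℝ)) hℓ hτ
    (by positivity) (by positivity) (by positivity) (norm_nonneg _) (by norm_num) (by positivity)
    (by positivity) (by positivity) (by positivity) (by positivity) (by positivity)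
    (by positivity) hC₃ hBM heM heN hc0 le_rfl hBW heW hWm hWw
  refine hmain.trans (le_of_eq ?_)
  ring

/-- **Z22:§10.u057 (i) HOLDS for `c′ ≥ 0`**: `Top1214Eval c′` — "the sum over `P^{0.498} ≤ dr < P^{0.5}`
is equal to `(1000ῑ₄L′(1,χ)²/log²P) Σ_{P^{0.498}≤n<P^{0.5}} |χ(n)|λ₀ⱼ(n)φ(n)⁻¹𝔣_{j7}(P^{0.5}/n)
(1 + 𝔶_{2j}(P^{0.004}n)) + o(α)`", i.e. for every `ε > 0`, all large `D`, every real primitive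
`χ (mod D)` with (A) and `j ∈ {1,2,3}`: `‖S1214On(P^{0.498},P^{0.5}) − topSum1214‖ ≤ εα`. Inputs, all
tree theorems: Lemma 8.2 (`Skeleton.lemma82_holds`, needs `c′ ≥ 0`), the shifted (10.10)ᴿ from
LEMMA A and Lemma 8.3ᴿ (`Lemma102.eq1010SRel_of_logMean`, `logMeanRel_of_lemma83Rel`,
`lemma83Rel_holds`), the weak window bound `Lemma102.frakv2S_le_ell4`, the main values
(`norm_frakfW7_P2_div_sub_le`, `norm_fraky2_yShift_sub_le`), (8.10), and the weights of
`Section10CRanges1422`. Error `≪_{c′} (𝓛^{1.1})⁵𝓛⁻¹⁵ = o(α)`.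
[cite: Zhang2022LandauSiegel, §10 p. 61, tex L3101] -/
theorem top1214Eval_holds {c' : ℝ} (hc' : 0 ≤ c') : Top1214Eval c' := by
  intro ε hε
  obtain ⟨C82, H82⟩ := lemma82_holds hc'
  obtain ⟨C₂, H10⟩ := Lemma102.eq1010SRel_of_logMean (c' := c')
    (Lemma102.logMeanRel_of_lemma83Rel (lemma83Rel_holds c'))
  obtain ⟨C₃, HW⟩ := Lemma102.frakv2S_le_ell4 c'
  set K : ℝ := Real.exp 256 *
          ((534 * Real.exp (9 / 2) + (5.75 * max C82 0 + 46000 * π * Real.exp (9 / 2))) *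
              (max C₂ 0 + 17000000 * π * Real.exp (9 / 2)) +
            161 * (5.75 * max C82 0 + 46000 * π * Real.exp (9 / 2)) * (2000 * Real.exp (9 / 2)) +
            537 * ((5.75 * (2 + 116 * Real.exp (9 / 2) + max C82 0)) * max C₃ 0 +
              161 * (534 * Real.exp (9 / 2)) * (2000 * Real.exp (9 / 2)))) with hK
  have hK0 : 0 ≤ K := by positivity
  set x : ℝ := max 5 (max (5 * |c'| * π) (K ^ 2 / (ε ^ 2 * π ^ 2))) with hx
  have FL : ForAllLarge fun D _ _ => 5 ≤ ell D ∧ 5 * |c'| * π ≤ ell D ∧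
      K ^ 2 / (ε ^ 2 * π ^ 2) ≤ ell D := by
    refine ForAllLarge.of_le ⌈Real.exp x⌉₊ fun D _ χ hD _ _ => ?_
    have hxℓ := le_ell_of_ceil_exp_le hD
    refine ⟨?_, ?_, ?_⟩ <;> refine le_trans ?_ hxℓ <;> simp [hx]
  refine (((H82.and H10).and HW).and FL).mono ?_
  intro D _ χ hq hp ⟨⟨⟨hA, hB⟩, hC⟩, h5, hc5, hKℓ⟩ hAss j hj
  have hℓ : 3 ≤ ell D := by linarith
  -- monotonicity of the bodies in the constants (`C ↦ max C 0`)
  have hA' : ∀ j ∈ ({1, 2, 3} : Finset ℕ), ∀ μ ∈ ({6, 7} : Finset ℕ), ∀ y : ℝ, bigT D < y →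
      y < bigP D →
      ‖(∑ m ∈ Finset.Ico 1 ⌈y⌉₊, χ (m : ZMod D) / (m : ℂ) ^ (1 - betaJ c' D j) *
            ((y / m : ℝ) : ℂ) ^ betaMu D μ * (Real.log (y / m) : ℂ)) -
          deriv χ.LFunction 1 * frakfW c' D j μ y‖ ≤ max C82 0 * (ell D ^ 6)⁻¹ :=
    fun j hj μ hμ y h1 h2 => (hA hAss j hj μ hμ y h1 h2).trans
      (mul_le_mul_of_nonneg_right (le_max_left _ _) (by positivity))
  have hB' : ∀ j ∈ ({1, 2, 3} : Finset ℕ), ∀ d r : ℕ, 1 ≤ d → 1 ≤ r →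
      bigP D ^ (0.502 : ℝ) < yShift D ((d * r : ℕ) : ℝ) →
      yShift D ((d * r : ℕ) : ℝ) ≤ bigP D ^ (0.504 : ℝ) / bigT D →
        ‖frakv2S c' χ j d r - 500 * deriv χ.LFunction 1 * PiW χ d r / Real.log (bigP D) *
            (1 + fraky2 c' D j (yShift D ((d * r : ℕ) : ℝ)))‖ ≤
          max C₂ 0 * (ell D ^ 15)⁻¹ * (∏ q ∈ (d * r).primeFactors, (1 - (q : ℝ)⁻¹)⁻¹) ^ 2 :=
    fun j hj d r hd hr h1 h2 => (hB hAss j hj d r hd hr h1 h2).trans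
      (mul_le_mul_of_nonneg_right (mul_le_mul_of_nonneg_right (le_max_left _ _) (by positivity))
        (sq_nonneg _))
  have hC' : ∀ j ∈ ({1, 2, 3} : Finset ℕ), ∀ d r : ℕ, 1 ≤ d → 1 ≤ r →
      ((d * r : ℕ) : ℝ) < bigP D ^ (0.5 : ℝ) →
        ‖frakv2S c' χ j d r‖ ≤
          max C₃ 0 * (ell D ^ 4)⁻¹ * (∏ q ∈ (d * r).primeFactors, (1 - (q : ℝ)⁻¹)⁻¹) ^ 2 :=
    fun j hj d r hd hr h1 => (hC hAss j hj d r hd hr h1).trans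
      (mul_le_mul_of_nonneg_right (mul_le_mul_of_nonneg_right (le_max_left _ _) (by positivity))
        (sq_nonneg _))
  exact (top1214_at c' χ h5 hq hp (hc5_of_le c' hℓ hc5) (le_max_right _ _) (le_max_right _ _)
    (le_max_right _ _) hA' hB' hC' hj).trans (K_tau5_le_eps_alpha hK0 hε hℓ hKℓ)

end Final

end Top1214

/-- **Z22:§10.u057 (i), `Top1214Eval c′`, for `c′ ≥ 0`** — the closer name and shape requested by
the leaf holder zl-w10-p1 for the `Gather1214` assembly (`c′` explicit; see
`Top1214.top1214Eval_holds`). [cite: Zhang2022LandauSiegel, §10 p. 61, tex L3101] -/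
theorem top1214Eval_holds (c' : ℝ) (hc : 0 ≤ c') : Top1214Eval c' :=
  Top1214.top1214Eval_holds hc

end Literature.NumberTheory.LFunctions.Zhang2022.Typed.Sec10C
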